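/-
Copyright: cell `pub-ymgap` (HUMAN RULING D-0062), Track A, DAG node N21; seat `pub-ymgap-dag-n21-c` (generation 3), module 3.
-/
import Summits.QuantumFields.YangMills.Theorems.BalabanUVNodesN21LocalAveragedRegularityLevels
import Literature.MathematicalPhysics.QuantumFieldTheory.Balaban1983to89.T4AxialGaugeSmallField
import HarnessLib

/-!
# YM-DAG node N21 (= NE7c): the LOCAL [Balaban1985Averaging] Prop. 2 for the (0.4) averaging of record IN THE INTEGER-BOX CURRENCY
# `T4AxialGaugeSmallField.boxPlaqs lo hi` of the large-field literature and of the one-call END (`hcover : boxPlaqs lo hi ⊆ Pcore ∪ Pcollar`)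

Track A of `YM-PLAN.md` (cell `pub-ymgap`, HUMAN RULING D-0062), node **N21** = spine estimate NE7c (`T4IndicatorShell.ShellWeightBound`, NOT PRINTED,
NOT PROVED).  Seat `pub-ymgap-dag-n21-c` (director-ym R134 row s1), generation 3, successor item S4a, module 3 (module 1 `…N21LocalAveragedRegularity`:
sharp local Prop. 1; module 2 `…N21LocalAveragedRegularityLevels`: K-uniform local Prop. 2 along chains of block centres `xs i = emb (xs (i+1))` on
`N20LCSAvgDominationRegion.boxRegion`).  Kernel theorems only: 0 `def`, 0 `sorry`, standard axioms; COUNT-NEUTRAL (`--supports stmt-QuantumFields-19908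
--as helper`).

WHY.  The large-field files of the tree ([Balaban1989LargeFieldI] `B15Extension193.boxSites`, `T4AxialGaugeSmallField.boxPlaqs ∕ boxBonds`, the shell
gauges) and the one-call END of NE7c (`ShellMeasureLiveEndOneCallUnionLevelsCfLinJunction`, hypotheses `hcover : boxPlaqs (lo r K s) (hi r K s) ⊆ Pcore ∪
Pcollar`, `hcore : u(V′) < εη² → PlaqSmallOn Pcore a V′`) speak of plaquettes through INTEGER BOXES `[lo, hi] ⊂ ℤᵈ` projected to the torus by
`castSite`, not through `ℓ^∞`-balls around torus sites.  THIS FILE is the dictionary and the restatement: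
* §1 `boxPlaqs_subset_boxRegion` (a box inside `[c − ρ, c + ρ]` lies in the ball of radius `ρ` around `castSite c`), `boxRegion_subset_boxPlaqs`
  (the ball of radius `ρ` around `castSite c` lies in the box `[c − ρ, c + ρ + 1]`), `emb_castSite` (`emb (castSite c) = castSite (L·c + (L−1)/2)` — the
  centred convention of `Setup.emb`), **`castSite_centre_chain`** (the INTEGER chain of block centres below the coarse site `castSite c` of `T^{(k)}`:
  `c_i = L^{k−i}·c + (L^{k−i} − 1)/2`, `L` odd — `xs i = castSite c_i` satisfies `xs i = emb (xs (i+1))`), `castSite_centre_top`.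
* §2 **`plaqSmallOn_boxPlaqs_iter_blockAvg_eml`** = PROP. 2 LOCAL, BOX CURRENCY (any torus of `Setup`, `SU(N)`): if the fine configuration `U` on `T^{(0)}`
  satisfies `|U(∂q) − 1| < α₀η²` (`η = L^{−k}`) for every `q ∈ boxPlaqs (c₀ − R) (c₀ + R + 1)`, `c₀ = L^k·c + (L^k − 1)/2` the fine centre of the block tower
  over `c`, `R = L^k·(m + (d+4)L + 2)`, and `0 < α₀`, `C₀(d)α₀ ≤ ⅓`, `2α₀ ≤ c′₂`, then `|Ū^k(∂p) − 1| < α₀ + 2C₀(d)α₀²` for every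
  `p ∈ boxPlaqs lo hi` with `[lo, hi] ⊆ [c − m, c + m]` (module 2's `plaqSmallOn_iter_blockAvg_eml_loc_pow` through §1).
  `plaqSmallOn_boxPlaqs_iter_blockAvg_eml_level` ((53) on the intermediate boxes `[c_j − r_j, c_j + r_j]` of every level `j ≤ k`).
* §3 AT NODE 00: **`plaqSmallOn_boxPlaqs_datum_of_Uk`** — the END's γ3 reading `hcore` in box currency at ₈a's minimiser: `UkExists F N K k ε V` and
  `PlaqSmallOn (boxPlaqs (c₀ − R) (c₀ + R + 1)) (θη_k²) (Uk F N K k ε V)` ⇒ `PlaqSmallOn (boxPlaqs lo hi) (2θ) V` for `[lo, hi] ⊆ [c − m, c + m]`;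
  `plaqSmallOn_boxPlaqs_datum_of_isBackground` (any minimising class); `plaqSmallOn_boxPlaqs_datum_of_Uk_slot_lt` (the slot variable read as any
  majorant `u < θη_k²` of `|U_k(V)(∂q) − 1|` over the fine box); `plaqSmallOn_boxPlaqs_iter_Uk_level` (every intermediate average `Ū^j(U_k V)` regular on
  the intermediate boxes).
* §4 VACUITY GUARD `boxPlaqs_datum_of_Uk_fires_levelZero_flat`: at the trivial level the binders of §3 are jointly inhabited (flat datum,
  `Node00.ukExists_zero_iff ∕ Uk_zero`) and the theorem fires.

HONEST FRAMING.  The fine box has half-width `L^k(m + (d+4)L + 2)` around the centre of the block tower — in coarse units `(d+4)L + 2` blocks beyond the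
target box `[c − m, c + m]` (module 2's walk-hull margin `≈ d + 6` blocks, crudely majorised by the closed form `nested_radii_pow`; print: one block).  Species of `hcore` at NODE 00's
objects (`Node00.Uk`, `avOfRecord`), NOT the literal hypothesis of p241094 (its letters `u`, `Pcore`, `classifier` are NODE O's dictionary).  Nothing of
Bałaban's asserted; NE7c NOT PRINTED ∕ NOT PROVED; (M1) untouched; N21 NOT discharged; typed 28∕28, count untouched; one finite torus at fixed `ε` — NOT
ℝ⁴ ∕ infinite volume ∕ OS ∕ mass gap ∕ Clay.
References: T. Bałaban, CMP 98 (1985) 17–51 [Balaban1985Averaging] (Prop. 2 (52)–(54) p. 26); CMP 109 (1987) 249–301 [Balaban1987RG1] ((0.1)–(0.3)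
pp. 251–252); CMP 122 (1989) 175–202 [Balaban1989LargeFieldI] (p. 193, the boxes `Λ`).
-/

noncomputable section

open scoped BigOperators
namespace Summit.QuantumFields.YangMills.Theorems.N21LocalAveragedRegularity

open Literature.MathematicalPhysics.QuantumFieldTheory.Balaban1983to89
open T4Continuum BlockAveraging AveragingRT ExpMeanLog BlockAveragingEMLProp2
open T4AxialGaugeSmallField (castSite castSite_apply boxPlaqs)
open B7Prop1Explicit (e e_apply)
open Summit.QuantumFields.YangMills.BalabanUVNodes.N20LCSAvgDominationRegion (boxRegion mem_boxRegion mem_boxRegion_of_corner)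

variable {P : Params} {j : ℕ}

/-! ## §1 Integer boxes versus `ℓ^∞`-balls, and the integer chain of block centres -/

section Boxes

/-- **AN INTEGER BOX INSIDE `[c − ρ, c + ρ]` LIES IN THE BALL OF RADIUS `ρ` AROUND `castSite c`**: `boxPlaqs lo hi ⊆ boxRegion (castSite c) ρ` whenever
`c − ρ ≤ lo` and `hi ≤ c + ρ` coordinatewise (the corner `castSite z`, `lo ≤ z ≤ hi`, has offset `z − c`). [cite: Balaban1987RG1, (0.1) p.251] -/
theorem boxPlaqs_subset_boxRegion (c lo hi : Fin P.d → ℤ) (ρ : ℕ) (hlo : ∀ ν, c ν - ρ ≤ lo ν) (hhi : ∀ ν, hi ν ≤ c ν + ρ) :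
    (boxPlaqs lo hi : Set (Plaq P j)) ⊆ (↑(boxRegion (castSite c : Site P j) ρ) : Set (Plaq P j)) := by
  rintro p ⟨z, hzlo, hzhi, hp⟩
  refine Finset.mem_coe.mpr (mem_boxRegion.mpr fun ν => ⟨z ν - c ν, ?_, ?_⟩)
  · have h1 : lo ν ≤ z ν := hzlo ν
    have h2 : z ν ≤ hi ν := by
      have h := hzhi ν
      simp only [Pi.add_apply, e_apply] at h
      split_ifs at h <;> omega
    have h3 := hlo ν
    have h4 := hhi ν
    rw [abs_le]
    constructor <;> omega
  · rw [hp, castSite_apply, castSite_apply]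
    push_cast
    ring

/-- **THE BALL OF RADIUS `ρ` AROUND `castSite c` LIES IN THE INTEGER BOX `[c − ρ, c + ρ + 1]`** (the far corner of a plaquette is one step beyond its
base in two distinct directions). [cite: Balaban1987RG1, (0.1) p.251] -/
theorem boxRegion_subset_boxPlaqs (c : Fin P.d → ℤ) (ρ : ℕ) :
    (↑(boxRegion (castSite c : Site P j) ρ) : Set (Plaq P j)) ⊆ boxPlaqs (fun ν => c ν - ρ) (fun ν => c ν + ρ + 1) := by
  intro q hq
  have h := mem_boxRegion.mp (Finset.mem_coe.mp hq)
  choose ev hev hq' using h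
  refine ⟨fun ν => c ν + ev ν, fun ν => ?_, fun ν => ?_, ?_⟩
  · have h1 := (abs_le.mp (hev ν)).1
    show c ν - ρ ≤ c ν + ev ν
    omega
  · have h2 := (abs_le.mp (hev ν)).2
    have hμν : q.μ ≠ q.ν := q.hμν.ne
    simp only [Pi.add_apply, e_apply]
    by_cases ha : ν = q.μ
    · by_cases hb : ν = q.ν
      · exact absurd (ha.symm.trans hb) hμν
      · rw [if_pos ha, if_neg hb]; omega
    · by_cases hb : ν = q.ν
      · rw [if_neg ha, if_pos hb]; omega
      · rw [if_neg ha, if_neg hb]; omega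
  · funext ν
    rw [hq' ν, castSite_apply, castSite_apply]
    push_cast
    ring

/-- **BLOCK CENTRES OF INTEGER SITES** (the centred convention of `Setup.emb`, `n ↦ nL + (L−1)/2`): `emb (castSite c) = castSite (L·c + (L−1)/2)`.
[cite: Balaban1987RG1, (0.1) p.252] -/
theorem emb_castSite (c : Fin P.d → ℤ) :
    emb (castSite c : Site P (j + 1)) = (castSite (fun ν => (P.L : ℤ) * c ν + (((P.L - 1) / 2 : ℕ) : ℤ)) : Site P j) := by
  funext κ
  rw [Site.emb_apply_eq, castSite_apply, castSite_apply, scaleCoord_intCast]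
  simp only [Int.cast_add, Int.cast_mul, Int.cast_natCast]
  ring

/-- **THE INTEGER CHAIN OF BLOCK CENTRES**: for a site `castSite c` of `T^{(k)}`, the integer centres `c_i = L^{k−i}·c + (L^{k−i} − 1)/2` (`L` odd, so the
halves are exact) project to a chain `xs i = castSite c_i` with `xs i = emb (xs (i+1))` for `i < k` — the centres of the tower of blocks
`B^{k−i}(c) ⊂ T^{(i)}` over `c`. [cite: Balaban1987RG1, (0.1)–(0.3) pp.251–252] -/
theorem castSite_centre_chain (k : ℕ) (c : Fin P.d → ℤ) (i : ℕ) (hi : i < k) :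
    (castSite (fun ν => (P.L : ℤ) ^ (k - i) * c ν + (((P.L ^ (k - i) - 1) / 2 : ℕ) : ℤ)) : Site P i) =
      emb (castSite (fun ν => (P.L : ℤ) ^ (k - (i + 1)) * c ν + (((P.L ^ (k - (i + 1)) - 1) / 2 : ℕ) : ℤ)) : Site P (i + 1)) := by
  rw [emb_castSite]
  congr 1
  funext ν
  have hki : k - i = (k - (i + 1)) + 1 := by omega
  rw [hki]
  generalize k - (i + 1) = m
  obtain ⟨t, ht⟩ : Odd (P.L ^ m) := P.hL.1.pow
  obtain ⟨s, hs⟩ : Odd P.L := P.hL.1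
  obtain ⟨w, hw⟩ : Odd (P.L ^ (m + 1)) := P.hL.1.pow
  have hA : (P.L ^ m - 1) / 2 = t := by omega
  have hB : (P.L - 1) / 2 = s := by omega
  have hC : (P.L ^ (m + 1) - 1) / 2 = w := by omega
  rw [hA, hB, hC]
  have hpow : (P.L : ℤ) ^ (m + 1) = (P.L : ℤ) * (P.L : ℤ) ^ m := by ring
  have ht' : ((P.L : ℤ)) ^ m = 2 * (t : ℤ) + 1 := by exact_mod_cast ht
  have hs' : (P.L : ℤ) = 2 * (s : ℤ) + 1 := by exact_mod_cast hs
  have hw' : ((P.L : ℤ)) ^ (m + 1) = 2 * (w : ℤ) + 1 := by exact_mod_cast hw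
  -- `2·(L t + s) = L(L^m − 1) + (L − 1) = L^{m+1} − 1 = 2w`
  have key2 : 2 * ((P.L : ℤ) * (t : ℤ) + (s : ℤ)) = 2 * (w : ℤ) := by
    linear_combination (-(P.L : ℤ)) * ht' - hs' + hw'
  have key : (P.L : ℤ) * (t : ℤ) + (s : ℤ) = (w : ℤ) := by omega
  linear_combination key.symm

/-- The top of the integer chain is `castSite c` itself (`L^0·c + 0`). [folklore] -/
theorem castSite_centre_top (k : ℕ) (c : Fin P.d → ℤ) :
    (castSite (fun ν => (P.L : ℤ) ^ (k - k) * c ν + (((P.L ^ (k - k) - 1) / 2 : ℕ) : ℤ)) : Site P k) = castSite c := by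
  congr 1
  funext ν
  simp

end Boxes

/-! ## §2 Proposition 2 local, box currency -/

section Prop2

open scoped Matrix.Norms.L2Operator

variable {n : Type*} [Fintype n] [DecidableEq n] [Nonempty n]

/-- **[Balaban1985Averaging] PROP. 2 (52) ⇒ (54) FOR THE (0.4) AVERAGING OF RECORD, LOCAL, IN INTEGER BOXES.**  Let `c ∈ ℤᵈ` label a site of `T^{(k)}`,
`c₀ = L^k·c + (L^k − 1)/2` the integer centre of the block tower over it in `T^{(0)}`, `R = L^k·(m + (d+4)L + 2)`.  If `|U(∂q) − 1| < α₀η²` (`η = L^{−k}`)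
for every fine plaquette `q ∈ boxPlaqs (c₀ − R) (c₀ + R + 1)` and `0 < α₀`, `C₀(d)α₀ ≤ ⅓`, `2α₀ ≤ c′₂ = 2δ_N/((d+4)L)²`, then `|Ū^k(∂p) − 1| < α₀ + 2C₀(d)α₀²`
for every coarse plaquette `p ∈ boxPlaqs lo hi`, `[lo, hi] ⊆ [c − m, c + m]` (module 2's `plaqSmallOn_iter_blockAvg_eml_loc_pow` along the integer chain
`castSite_centre_chain`, through §1). [cite: Balaban1985Averaging, Prop. 2 (52)–(54) p.26] -/
theorem plaqSmallOn_boxPlaqs_iter_blockAvg_eml (k : ℕ) {α₀ : ℝ} (hα : 0 < α₀)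
    (hα3 : (143 * ((((P.d + 4 : ℕ) : ℝ)) ^ 2 / 4) ^ 2) * α₀ ≤ 1 / 3)
    (hα2 : 2 * α₀ ≤ 2 * deltaSU n / (((P.d + 4) * P.L : ℕ) : ℝ) ^ 2) (c : Fin P.d → ℤ) (m : ℕ)
    {U : GaugeField P 0 (Matrix.specialUnitaryGroup n ℂ)}
    (h52 : PlaqSmallOn (boxPlaqs
        (fun ν => (P.L : ℤ) ^ k * c ν + (((P.L ^ k - 1) / 2 : ℕ) : ℤ) - ((P.L ^ k * (m + ((P.d + 4) * P.L + 2)) : ℕ) : ℤ))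
        (fun ν => (P.L : ℤ) ^ k * c ν + (((P.L ^ k - 1) / 2 : ℕ) : ℤ) + ((P.L ^ k * (m + ((P.d + 4) * P.L + 2)) : ℕ) : ℤ) + 1) : Set (Plaq P 0))
      (α₀ * (((P.L : ℝ) ^ k)⁻¹) ^ 2) U)
    {lo hi : Fin P.d → ℤ} (hlo : ∀ ν, c ν - m ≤ lo ν) (hhi : ∀ ν, hi ν ≤ c ν + m) :
    PlaqSmallOn (boxPlaqs lo hi : Set (Plaq P k)) (α₀ + 2 * (143 * ((((P.d + 4 : ℕ) : ℝ)) ^ 2 / 4) ^ 2) * α₀ ^ 2)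
      (Averaging.iter (fun _ => blockAvg (expMeanLogSU (n := n))) k U) := by
  -- the integer chain of block centres below `castSite c`
  set xs : (i : ℕ) → Site P i :=
    fun i => castSite (fun ν => (P.L : ℤ) ^ (k - i) * c ν + (((P.L ^ (k - i) - 1) / 2 : ℕ) : ℤ)) with hxs_def
  have hxs : ∀ i < k, xs i = emb (xs (i + 1)) := fun i hi => castSite_centre_chain k c i hi
  have hx0 : xs 0 = castSite (fun ν => (P.L : ℤ) ^ k * c ν + (((P.L ^ k - 1) / 2 : ℕ) : ℤ)) := by
    simp only [hxs_def, Nat.sub_zero]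
  have hxk : xs k = castSite c := castSite_centre_top k c
  -- hypothesis on the ball of radius `R` around `xs 0`
  have h52' : PlaqSmallOn (↑(boxRegion (xs 0) (P.L ^ k * (m + ((P.d + 4) * P.L + 2)))) : Set (Plaq P 0))
      (α₀ * (((P.L : ℝ) ^ k)⁻¹) ^ 2) U := fun q hq => by
    rw [hx0] at hq
    exact h52 q (boxRegion_subset_boxPlaqs _ _ hq)
  have h := plaqSmallOn_iter_blockAvg_eml_loc_pow k hα hα3 hα2 xs hxs m h52'
  rw [hxk] at h
  exact fun p hp => h p (boxPlaqs_subset_boxRegion c lo hi m hlo hhi hp)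

/-- **ALL INTERMEDIATE LEVELS (53), BOX CURRENCY**: under the same hypotheses, for every `j ≤ k` the `j`-fold average satisfies `|Ū^j(∂p) − 1| <
2α₀(L^jη)²` (`η = L^{−k}`) for every plaquette `p ∈ boxPlaqs lo hi` of `T^{(j)}` with `[lo, hi] ⊆ [c_j − r_j, c_j + r_j]`, `c_j = L^{k−j}·c + (L^{k−j} − 1)/2`
the centre of the tower at level `j` and `r_j = L^{k−j}·(m + (d+4)L + 2) − ((d+4)L + 2)` the closed-form radius of `nested_radii_pow` (module 2's
`plaqSmallOn_iter_blockAvg_eml_loc_level`). [cite: Balaban1985Averaging, (53) p.26] -/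
theorem plaqSmallOn_boxPlaqs_iter_blockAvg_eml_level (k : ℕ) {α₀ : ℝ} (hα : 0 < α₀)
    (hα3 : (143 * ((((P.d + 4 : ℕ) : ℝ)) ^ 2 / 4) ^ 2) * α₀ ≤ 1 / 3)
    (hα2 : 2 * α₀ ≤ 2 * deltaSU n / (((P.d + 4) * P.L : ℕ) : ℝ) ^ 2) (c : Fin P.d → ℤ) (m : ℕ)
    {U : GaugeField P 0 (Matrix.specialUnitaryGroup n ℂ)}
    (h52 : PlaqSmallOn (boxPlaqs
        (fun ν => (P.L : ℤ) ^ k * c ν + (((P.L ^ k - 1) / 2 : ℕ) : ℤ) - ((P.L ^ k * (m + ((P.d + 4) * P.L + 2)) : ℕ) : ℤ))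
        (fun ν => (P.L : ℤ) ^ k * c ν + (((P.L ^ k - 1) / 2 : ℕ) : ℤ) + ((P.L ^ k * (m + ((P.d + 4) * P.L + 2)) : ℕ) : ℤ) + 1) : Set (Plaq P 0))
      (α₀ * (((P.L : ℝ) ^ k)⁻¹) ^ 2) U)
    {j : ℕ} (hj : j ≤ k) {lo hi : Fin P.d → ℤ}
    (hlo : ∀ ν, (P.L : ℤ) ^ (k - j) * c ν + (((P.L ^ (k - j) - 1) / 2 : ℕ) : ℤ) -
      ((P.L ^ (k - j) * (m + ((P.d + 4) * P.L + 2)) - ((P.d + 4) * P.L + 2) : ℕ) : ℤ) ≤ lo ν)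
    (hhi : ∀ ν, hi ν ≤ (P.L : ℤ) ^ (k - j) * c ν + (((P.L ^ (k - j) - 1) / 2 : ℕ) : ℤ) +
      ((P.L ^ (k - j) * (m + ((P.d + 4) * P.L + 2)) - ((P.d + 4) * P.L + 2) : ℕ) : ℤ)) :
    PlaqSmallOn (boxPlaqs lo hi : Set (Plaq P j)) (2 * α₀ * ((P.L : ℝ) ^ j * ((P.L : ℝ) ^ k)⁻¹) ^ 2)
      (Averaging.iter (fun _ => blockAvg (expMeanLogSU (n := n))) j U) := by
  set xs : (i : ℕ) → Site P i :=
    fun i => castSite (fun ν => (P.L : ℤ) ^ (k - i) * c ν + (((P.L ^ (k - i) - 1) / 2 : ℕ) : ℤ)) with hxs_def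
  have hxs : ∀ i < k, xs i = emb (xs (i + 1)) := fun i hi => castSite_centre_chain k c i hi
  have hx0 : xs 0 = castSite (fun ν => (P.L : ℤ) ^ k * c ν + (((P.L ^ k - 1) / 2 : ℕ) : ℤ)) := by
    simp only [hxs_def, Nat.sub_zero]
  obtain ⟨hr, -, hr0⟩ := nested_radii_pow (P := P) k m
  have h52' : PlaqSmallOn (↑(boxRegion (xs 0) (P.L ^ (k - 0) * (m + ((P.d + 4) * P.L + 2)) - ((P.d + 4) * P.L + 2))) : Set (Plaq P 0))
      (α₀ * (((P.L : ℝ) ^ k)⁻¹) ^ 2) U := fun q hq => by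
    rw [hx0] at hq
    exact h52 q (boxRegion_subset_boxPlaqs _ _ (Finset.mem_coe.mpr (boxRegion_mono _ hr0 (Finset.mem_coe.mp hq))))
  have h := plaqSmallOn_iter_blockAvg_eml_loc_level k hα hα3 hα2 xs hxs
    (fun i => P.L ^ (k - i) * (m + ((P.d + 4) * P.L + 2)) - ((P.d + 4) * P.L + 2)) hr h52' hj
  exact fun p hp => h p (boxPlaqs_subset_boxRegion _ lo hi _ hlo hhi hp)

end Prop2

/-! ## §3 At NODE 00: the END's γ3 reading `hcore`, box currency -/

section Node00

open Literature.MathematicalPhysics.QuantumFieldTheory.Balaban1983to89.T4Continuum (T4Family)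
open Literature.MathematicalPhysics.QuantumFieldTheory.Balaban1983to89.Node00

variable {F : T4Family} {N : ℕ} [NeZero N]

/-- **PROP. 2 LOCAL IN INTEGER BOXES AT NODE 00's AVERAGING OF RECORD** (`avOfRecord F N K`, `η_k = Params.eta k`): (52) with `α₀η_k²` on the fine box
`[c₀ − R, c₀ + R + 1]`, `c₀ = L^k·c + (L^k − 1)/2`, `R = L^k(m + (d+4)L + 2)` ⇒ `|Ū^k(∂p) − 1| < 2α₀` on every `boxPlaqs lo hi`, `[lo, hi] ⊆ [c − m, c + m]`.
[cite: Balaban1985Averaging, Prop. 2 (52)–(54) p.26] -/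
theorem plaqSmallOn_boxPlaqs_iter_avOfRecord (K k : ℕ) {α₀ : ℝ} (hα : 0 < α₀)
    (hα3 : (143 * (((((F.P K).d + 4 : ℕ) : ℝ)) ^ 2 / 4) ^ 2) * α₀ ≤ 1 / 3)
    (hα2 : 2 * α₀ ≤ 2 * deltaSU (Fin N) / ((((F.P K).d + 4) * (F.P K).L : ℕ) : ℝ) ^ 2) (c : Fin (F.P K).d → ℤ) (m : ℕ)
    {U : GaugeField (F.P K) 0 (SU N)}
    (h52 : PlaqSmallOn (boxPlaqs
        (fun ν => ((F.P K).L : ℤ) ^ k * c ν + ((((F.P K).L ^ k - 1) / 2 : ℕ) : ℤ) -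
          (((F.P K).L ^ k * (m + (((F.P K).d + 4) * (F.P K).L + 2)) : ℕ) : ℤ))
        (fun ν => ((F.P K).L : ℤ) ^ k * c ν + ((((F.P K).L ^ k - 1) / 2 : ℕ) : ℤ) +
          (((F.P K).L ^ k * (m + (((F.P K).d + 4) * (F.P K).L + 2)) : ℕ) : ℤ) + 1) : Set (Plaq (F.P K) 0))
      (α₀ * (F.P K).eta k ^ 2) U)
    {lo hi : Fin (F.P K).d → ℤ} (hlo : ∀ ν, c ν - m ≤ lo ν) (hhi : ∀ ν, hi ν ≤ c ν + m) :
    PlaqSmallOn (boxPlaqs lo hi : Set (Plaq (F.P K) k)) (2 * α₀) (Averaging.iter (avOfRecord F N K) k U) := by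
  rw [Params.eta, inv_pow] at h52
  have h := plaqSmallOn_boxPlaqs_iter_blockAvg_eml (n := Fin N) k hα hα3 hα2 c m h52 hlo hhi
  intro p hp
  exact (h p hp).trans (B7.prop2_bound_lt_two_alpha _ α₀ hα hα3)

/-- **THE ONE-CALL END's γ3 READING `hcore` AT ₈a's MINIMISER, BOX CURRENCY**: on the solvable set (`UkExists`), if the background of record
`U_k(V) = Node00.Uk F N K k ε V` is `θη_k²`-plaquette-small on the fine integer box `[c₀ − R, c₀ + R + 1]` around the centre `c₀ = L^k·c + (L^k − 1)/2` of the
block tower over `c` (`R = L^k(m + (d+4)L + 2)`, an admissible `θ`), then the datum `V` is `2θ`-plaquette-small on every coarse box `boxPlaqs lo hi` with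
`[lo, hi] ⊆ [c − m, c + m]` — the letter shapes of the END (`PlaqSmallOn (boxPlaqs …)`, `hcover`), at NODE 00's objects (`Node00.iter_Uk`).
[cite: Balaban1985Averaging, Prop. 2 (52)–(54) p.26] -/
theorem plaqSmallOn_boxPlaqs_datum_of_Uk (K k : ℕ) {ε θ : ℝ} (hθ : 0 < θ)
    (hθ3 : (143 * (((((F.P K).d + 4 : ℕ) : ℝ)) ^ 2 / 4) ^ 2) * θ ≤ 1 / 3)
    (hθ2 : 2 * θ ≤ 2 * deltaSU (Fin N) / ((((F.P K).d + 4) * (F.P K).L : ℕ) : ℝ) ^ 2) (c : Fin (F.P K).d → ℤ) (m : ℕ)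
    {V : GaugeField (F.P K) k (SU N)} (h : UkExists F N K k ε V)
    (hu : PlaqSmallOn (boxPlaqs
        (fun ν => ((F.P K).L : ℤ) ^ k * c ν + ((((F.P K).L ^ k - 1) / 2 : ℕ) : ℤ) -
          (((F.P K).L ^ k * (m + (((F.P K).d + 4) * (F.P K).L + 2)) : ℕ) : ℤ))
        (fun ν => ((F.P K).L : ℤ) ^ k * c ν + ((((F.P K).L ^ k - 1) / 2 : ℕ) : ℤ) +
          (((F.P K).L ^ k * (m + (((F.P K).d + 4) * (F.P K).L + 2)) : ℕ) : ℤ) + 1) : Set (Plaq (F.P K) 0))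
      (θ * (F.P K).eta k ^ 2) (Uk F N K k ε V))
    {lo hi : Fin (F.P K).d → ℤ} (hlo : ∀ ν, c ν - m ≤ lo ν) (hhi : ∀ ν, hi ν ≤ c ν + m) :
    PlaqSmallOn (boxPlaqs lo hi : Set (Plaq (F.P K) k)) (2 * θ) V := by
  have key := plaqSmallOn_boxPlaqs_iter_avOfRecord K k hθ hθ3 hθ2 c m hu hlo hhi
  rwa [iter_Uk h] at key

/-- **ANY MINIMISER WITH A BACKGROUND REGULAR ON THE FINE BOX HAS A DATUM REGULAR ON THE COARSE BOX** (`Setup.IsBackground` along `avOfRecord`, any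
class `C`): `U₀` `θη_k²`-small on `[c₀ − R, c₀ + R + 1]` ⇒ `V = Ū₀^k` `2θ`-small on `boxPlaqs lo hi`, `[lo, hi] ⊆ [c − m, c + m]`.
[cite: Balaban1985Averaging, Prop. 2 (52)–(54) p.26] -/
theorem plaqSmallOn_boxPlaqs_datum_of_isBackground (K k : ℕ) {θ : ℝ} (hθ : 0 < θ)
    (hθ3 : (143 * (((((F.P K).d + 4 : ℕ) : ℝ)) ^ 2 / 4) ^ 2) * θ ≤ 1 / 3)
    (hθ2 : 2 * θ ≤ 2 * deltaSU (Fin N) / ((((F.P K).d + 4) * (F.P K).L : ℕ) : ℝ) ^ 2) (c : Fin (F.P K).d → ℤ) (m : ℕ)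
    {C : Set (GaugeField (F.P K) 0 (SU N))} {V : GaugeField (F.P K) k (SU N)} {U₀ : GaugeField (F.P K) 0 (SU N)}
    (hU₀ : IsBackground (avOfRecord F N K) C k V U₀)
    (hu : PlaqSmallOn (boxPlaqs
        (fun ν => ((F.P K).L : ℤ) ^ k * c ν + ((((F.P K).L ^ k - 1) / 2 : ℕ) : ℤ) -
          (((F.P K).L ^ k * (m + (((F.P K).d + 4) * (F.P K).L + 2)) : ℕ) : ℤ))
        (fun ν => ((F.P K).L : ℤ) ^ k * c ν + ((((F.P K).L ^ k - 1) / 2 : ℕ) : ℤ) +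
          (((F.P K).L ^ k * (m + (((F.P K).d + 4) * (F.P K).L + 2)) : ℕ) : ℤ) + 1) : Set (Plaq (F.P K) 0))
      (θ * (F.P K).eta k ^ 2) U₀)
    {lo hi : Fin (F.P K).d → ℤ} (hlo : ∀ ν, c ν - m ≤ lo ν) (hhi : ∀ ν, hi ν ≤ c ν + m) :
    PlaqSmallOn (boxPlaqs lo hi : Set (Plaq (F.P K) k)) (2 * θ) V := by
  have key := plaqSmallOn_boxPlaqs_iter_avOfRecord K k hθ hθ3 hθ2 c m hu hlo hhi
  rwa [hU₀.1] at key

/-- **«SLOT VARIABLE `< θη_k²` ⇒ DATUM `2θ`-SMALL ON THE BOX»** — the END's `hcore` with the slot variable read as ANY majorant `u` of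
`|U_k(V)(∂q) − 1|` over the fine box (e.g. the block-sup of the γ3 reading): `u < θη_k²` ⇒ `PlaqSmallOn (boxPlaqs lo hi) (2θ) V`, `[lo, hi] ⊆ [c − m, c + m]`.
[cite: Balaban1985Averaging, Prop. 2 (52)–(54) p.26] -/
theorem plaqSmallOn_boxPlaqs_datum_of_Uk_slot_lt (K k : ℕ) {ε θ u : ℝ} (hθ : 0 < θ)
    (hθ3 : (143 * (((((F.P K).d + 4 : ℕ) : ℝ)) ^ 2 / 4) ^ 2) * θ ≤ 1 / 3)
    (hθ2 : 2 * θ ≤ 2 * deltaSU (Fin N) / ((((F.P K).d + 4) * (F.P K).L : ℕ) : ℝ) ^ 2) (c : Fin (F.P K).d → ℤ) (m : ℕ)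
    {V : GaugeField (F.P K) k (SU N)} (h : UkExists F N K k ε V)
    (hslot : ∀ q ∈ (boxPlaqs
        (fun ν => ((F.P K).L : ℤ) ^ k * c ν + ((((F.P K).L ^ k - 1) / 2 : ℕ) : ℤ) -
          (((F.P K).L ^ k * (m + (((F.P K).d + 4) * (F.P K).L + 2)) : ℕ) : ℤ))
        (fun ν => ((F.P K).L : ℤ) ^ k * c ν + ((((F.P K).L ^ k - 1) / 2 : ℕ) : ℤ) +
          (((F.P K).L ^ k * (m + (((F.P K).d + 4) * (F.P K).L + 2)) : ℕ) : ℤ) + 1) : Set (Plaq (F.P K) 0)),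
      dist1 (GaugeField.plaqHol (Uk F N K k ε V) q) ≤ u)
    (hu : u < θ * (F.P K).eta k ^ 2)
    {lo hi : Fin (F.P K).d → ℤ} (hlo : ∀ ν, c ν - m ≤ lo ν) (hhi : ∀ ν, hi ν ≤ c ν + m) :
    PlaqSmallOn (boxPlaqs lo hi : Set (Plaq (F.P K) k)) (2 * θ) V :=
  plaqSmallOn_boxPlaqs_datum_of_Uk K k hθ hθ3 hθ2 c m h (fun q hq => (hslot q hq).trans_lt hu) hlo hhi

/-- **EVERY INTERMEDIATE AVERAGE OF ₈a's MINIMISER IS REGULAR ON THE INTERMEDIATE BOXES** ((53) at NODE 00, box currency): on the solvable set, if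
`U_k(V)` is `θη_k²`-small on the fine box `[c₀ − R, c₀ + R + 1]`, then for every `j ≤ k` the `j`-fold average `Ū^j(U_k(V))` is `2θ(L^jη_k)²`-small on every
`boxPlaqs lo hi` of `T^{(j)}` inside `[c_j − r_j, c_j + r_j]` (`c_j = L^{k−j}·c + (L^{k−j} − 1)/2`, `r_j = L^{k−j}(m + (d+4)L + 2) − ((d+4)L + 2)`) — the local
form of generation 2's `N21AveragedDatumRegularity.plaqSmall_iter_Uk_level`. [cite: Balaban1985Averaging, (53) p.26] -/
theorem plaqSmallOn_boxPlaqs_iter_Uk_level (K k : ℕ) {ε θ : ℝ} (hθ : 0 < θ)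
    (hθ3 : (143 * (((((F.P K).d + 4 : ℕ) : ℝ)) ^ 2 / 4) ^ 2) * θ ≤ 1 / 3)
    (hθ2 : 2 * θ ≤ 2 * deltaSU (Fin N) / ((((F.P K).d + 4) * (F.P K).L : ℕ) : ℝ) ^ 2) (c : Fin (F.P K).d → ℤ) (m : ℕ)
    {V : GaugeField (F.P K) k (SU N)}
    (hu : PlaqSmallOn (boxPlaqs
        (fun ν => ((F.P K).L : ℤ) ^ k * c ν + ((((F.P K).L ^ k - 1) / 2 : ℕ) : ℤ) -
          (((F.P K).L ^ k * (m + (((F.P K).d + 4) * (F.P K).L + 2)) : ℕ) : ℤ))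
        (fun ν => ((F.P K).L : ℤ) ^ k * c ν + ((((F.P K).L ^ k - 1) / 2 : ℕ) : ℤ) +
          (((F.P K).L ^ k * (m + (((F.P K).d + 4) * (F.P K).L + 2)) : ℕ) : ℤ) + 1) : Set (Plaq (F.P K) 0))
      (θ * (F.P K).eta k ^ 2) (Uk F N K k ε V))
    {j : ℕ} (hj : j ≤ k) {lo hi : Fin (F.P K).d → ℤ}
    (hlo : ∀ ν, ((F.P K).L : ℤ) ^ (k - j) * c ν + ((((F.P K).L ^ (k - j) - 1) / 2 : ℕ) : ℤ) -
      (((F.P K).L ^ (k - j) * (m + (((F.P K).d + 4) * (F.P K).L + 2)) - (((F.P K).d + 4) * (F.P K).L + 2) : ℕ) : ℤ) ≤ lo ν)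
    (hhi : ∀ ν, hi ν ≤ ((F.P K).L : ℤ) ^ (k - j) * c ν + ((((F.P K).L ^ (k - j) - 1) / 2 : ℕ) : ℤ) +
      (((F.P K).L ^ (k - j) * (m + (((F.P K).d + 4) * (F.P K).L + 2)) - (((F.P K).d + 4) * (F.P K).L + 2) : ℕ) : ℤ)) :
    PlaqSmallOn (boxPlaqs lo hi : Set (Plaq (F.P K) j)) (2 * θ * (((F.P K).L : ℝ) ^ j * (F.P K).eta k) ^ 2)
      (Averaging.iter (avOfRecord F N K) j (Uk F N K k ε V)) := by
  rw [Params.eta, inv_pow] at hu ⊢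
  exact plaqSmallOn_boxPlaqs_iter_blockAvg_eml_level (n := Fin N) k hθ hθ3 hθ2 c m hu hj hlo hhi

end Node00

/-! ## §4 Vacuity guard: the box-currency `hcore` reading FIRES at the trivial level -/

section Guard

open Literature.MathematicalPhysics.QuantumFieldTheory.Balaban1983to89.T4Continuum (T4Family)
open Literature.MathematicalPhysics.QuantumFieldTheory.Balaban1983to89.Node00

variable {F : T4Family} {N : ℕ} [NeZero N]

/-- **THE BINDERS OF `plaqSmallOn_boxPlaqs_datum_of_Uk` ARE JOINTLY INHABITED AND THE THEOREM FIRES** (trivial level `k = 0`, flat datum): for every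
admissible `θ > 0` (such `θ` exist: `N21AveragedDatumRegularity.smallness_inhabited`), ₈a's problem at the flat datum is solvable at level `0`
(`Node00.ukExists_zero_iff`), its minimiser of record is the flat configuration (`Node00.Uk_zero`) — `θη_0²`-small on every box — and the conclusion holds.
Nothing about the levels `k ≥ 1` (where `UkExists` is [Balaban1985Variational]'s Theorem 1, NODE 00 ∕ N07). [folklore] -/
theorem boxPlaqs_datum_of_Uk_fires_levelZero_flat (K : ℕ) {θ : ℝ} (hθ : 0 < θ)
    (hθ3 : (143 * (((((F.P K).d + 4 : ℕ) : ℝ)) ^ 2 / 4) ^ 2) * θ ≤ 1 / 3)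
    (hθ2 : 2 * θ ≤ 2 * deltaSU (Fin N) / ((((F.P K).d + 4) * (F.P K).L : ℕ) : ℝ) ^ 2) (c : Fin (F.P K).d → ℤ) (m : ℕ)
    {lo hi : Fin (F.P K).d → ℤ} (hlo : ∀ ν, c ν - m ≤ lo ν) (hhi : ∀ ν, hi ν ≤ c ν + m) :
    UkExists F N K 0 θ (1 : GaugeField (F.P K) 0 (SU N)) ∧
      PlaqSmallOn (boxPlaqs
        (fun ν => ((F.P K).L : ℤ) ^ 0 * c ν + ((((F.P K).L ^ 0 - 1) / 2 : ℕ) : ℤ) -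
          (((F.P K).L ^ 0 * (m + (((F.P K).d + 4) * (F.P K).L + 2)) : ℕ) : ℤ))
        (fun ν => ((F.P K).L : ℤ) ^ 0 * c ν + ((((F.P K).L ^ 0 - 1) / 2 : ℕ) : ℤ) +
          (((F.P K).L ^ 0 * (m + (((F.P K).d + 4) * (F.P K).L + 2)) : ℕ) : ℤ) + 1) : Set (Plaq (F.P K) 0))
        (θ * (F.P K).eta 0 ^ 2) (Uk F N K 0 θ (1 : GaugeField (F.P K) 0 (SU N))) ∧
      PlaqSmallOn (boxPlaqs lo hi : Set (Plaq (F.P K) 0)) (2 * θ) (1 : GaugeField (F.P K) 0 (SU N)) := by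
  have hflat : ∀ p : Plaq (F.P K) 0, GaugeField.plaqHol (1 : GaugeField (F.P K) 0 (SU N)) p = 1 := fun p => by
    simp [GaugeField.plaqHol, show ∀ b, (1 : GaugeField (F.P K) 0 (SU N)) b = 1 from fun _ => rfl]
  have hη : 0 < (F.P K).eta 0 := pow_pos (inv_pos.mpr (Nat.cast_pos.mpr (F.P K).L_pos)) 0
  have hθη : 0 < θ * (F.P K).eta 0 ^ 2 := mul_pos hθ (pow_pos hη 2)
  have hex : UkExists F N K 0 θ (1 : GaugeField (F.P K) 0 (SU N)) :=
    ukExists_zero_iff.2 ((mem_bgReg_iff F N K 0 θ _).2 fun p => by rw [hflat, GaugeGroup.dist1_one]; exact hθη)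
  have hu : PlaqSmallOn (boxPlaqs
        (fun ν => ((F.P K).L : ℤ) ^ 0 * c ν + ((((F.P K).L ^ 0 - 1) / 2 : ℕ) : ℤ) -
          (((F.P K).L ^ 0 * (m + (((F.P K).d + 4) * (F.P K).L + 2)) : ℕ) : ℤ))
        (fun ν => ((F.P K).L : ℤ) ^ 0 * c ν + ((((F.P K).L ^ 0 - 1) / 2 : ℕ) : ℤ) +
          (((F.P K).L ^ 0 * (m + (((F.P K).d + 4) * (F.P K).L + 2)) : ℕ) : ℤ) + 1) : Set (Plaq (F.P K) 0))
        (θ * (F.P K).eta 0 ^ 2) (Uk F N K 0 θ (1 : GaugeField (F.P K) 0 (SU N))) := by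
    rw [Uk_zero hex]
    intro p _
    rw [hflat, GaugeGroup.dist1_one]
    exact hθη
  exact ⟨hex, hu, plaqSmallOn_boxPlaqs_datum_of_Uk K 0 hθ hθ3 hθ2 c m hex hu hlo hhi⟩

end Guard

end Summit.QuantumFields.YangMills.Theorems.N21LocalAveragedRegularity

end
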